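import Literature.MathematicalPhysics.QuantumFieldTheory.Balaban1983to89.B9RWSums346SecondDiffGpDir

/-!
# `Balaban1983to89.B9RWSums346SecondDiffGpLeft` — [B9] the same-side second-order `L²` members (3.46)₃,₅ of Theorem 3.7's sum `G′(U)` BY THE LEFT NEUMANN SERIES
# `G′∇\*∇\* = Σₙ Vⁿ(G′₀∇\*∇\*)`, `V = Σ_□ M_{h_□}G′_□K(h_□)ᵗ` — NO THIRD-ORDER FACTOR (dag-n06-k's `l2line5_of_local37` ∕ dag-n06-c's `…_dir` with the displayed schema
# `FactorsL2Second37(Dir).facDD` REPLACED by an `L²` block bound of the FIRST-ORDER transposed walk factor `V`, itself derived from Corollary 3.6's letters)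

T. Bałaban, *Propagators for lattice gauge theories in a background field*, Commun. Math. Phys. **99** (1985) 389–434 [`Balaban1985BackgroundPropagators`, "B9"],
Thm 3.7 (3.87)–(3.90) pp. 408–410, (3.46) p. 398, p. 391; T. Bałaban, *Propagators and renormalization transformations for lattice gauge theories. II*, Commun. Math.
Phys. **96** (1984) 223–250 [`Balaban1984PropagatorsII`, "[4]"], (2.52)–(2.55) pp. 232–233, Lemma 2.1 (2.60)–(2.61) p. 234; T. Bałaban, *The variational problem and
background fields in renormalization group method for lattice gauge theories*, Commun. Math. Phys. **102** (1985) 277–309 [`Balaban1985Variational`], (188) p. 308.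

statement-level skeleton of published theorems with citation tags; proofs where landed; nothing here is a claim about the Yang–Mills mass gap

THE PRINT.  p. 409 (3.88)–(3.90): *«Δ′_aG′₀ = I − Σ_□K(h_□)G′_□h_□ = I − R′ … G′ = G′₀(I − R′)⁻¹ = Σ_ω …; the expansion is convergent in all norms appearing in the
inequalities (3.42)–(3.47)»*; p. 391: the adjoints are `L²` adjoints.  Transposing (3.88): `G′ = G′₀ + V·G′` (`B9Thm37KLetterDir.fixedPointT_dir`, `V = VDir`), hence
`G′∇\*_ν∇\*_μ = G′₀∇\*_ν∇\*_μ + V·(G′∇\*_ν∇\*_μ)` — a LEFT fixed-point equation whose kernel `V` is FIRST order in the cut-off derivatives.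
WHY (cell `pub-ymgap`, node N06 [B9], rows 18; width seat `pub-ymgap-dag-n06-w1` (g5); g4's NOTE (r3), bus I.36009).  The certificate's `h36H` displays `L2SecondLegs37` (head
legs; producer landed, p625928 → `B9Eq346SecondLegAtCubesTorusL2`) and `FactorsL2Second37Dir` (the terms `K(h_□)G′_□h_□∇\*∇\*` of `R′∇\*∇\*`, ORDER THREE — no producer in
print or tree).  The right form `G′∇\*∇\* = G′₀∇\*∇\* + G′(R′∇\*∇\*)` asks for it; the left form does not:
* §1 `exists_blockBd_const` — every linear map of finite lattices has SOME constant block-`L²` bound (the a-priori input of `B11SectG.neumann_majorant`);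
* §2 ★★ `l2line5_left_of_blockBd` (head legs `B₃, δ₁, N₃` + `hV : BlockBd blk blk V (θ_V·e^{−δ₁d})` + `θ_V·c₁(α₁) ≤ ½` + `Identities₂` + (2.61) ⊢
  `BlockBd blk blk (G′ ∘ (∇\*_ν ∘ ∇\*_μ)) (2N₃B₃·e^{−(1−α₁)δ₁d})`), ★ `l2line3_left_of_blockBd` (the fourth member by adjoint transfer);
* §3 `isTransposePair_VDir_RprimeDir`, ★★ `blockBd_VDir_of_local342` — `hV` DISCHARGED from Cor 3.6's sup majorants (`B9Thm37KLetterDir.hV_dir ∕ hR_dir`), the letter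
  transposes, the Schur test (`B9RWSums346Schur.blockBd_schur`) and p. 398's scale transfer: `BlockBd blk blk V (N′√(A_VA_RL₀)·e^{−(δ₀−αδ)d})`;
* §4 ★★★ `l2line5_left_of_local342`, ★★★ `blockBd_second_family5_left_of_local342` ∕ `…family3_left_of_local342` — the drop-in forms: the hypotheses of
  `l2line5_of_local37_dir` WITHOUT `FactorsL2Second37Dir`, plus `Local342 ∕ DirSupSq37` (displayed elsewhere in the certificate), the letter transposes, the smallness.
HONEST SCOPE.  Majorant bookkeeping over landed `L²` calculus (n06-k `B9SectDL2Decay` ∕ `B9RWSums346SecondDiff(Gp)`, b2b `B11SectG`); Corollary 3.6's legs and majorants,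
(3.88) (`Identities₂`) and the smallness are HYPOTHESES (schemas ∕ displayed inequalities); nothing of [B9] asserted; nobody's statement is modified; COUNT-NEUTRAL; N06 NOT
discharged; K1 NOT closed; one finite lattice programme — nothing continuum, nothing about OS positivity or the mass gap; the YM mass gap (Clay) is NOT proved by any of this —
R4 closes the conditional finite-𝕋⁴ rung `BalabanLadder.UV` only.  NEW file; 0 `def`.
-/

namespace Literature.MathematicalPhysics.QuantumFieldTheory.Balaban1983to89.B9RWSums346SecondDiffGpLeft

open Literature.MathematicalPhysics.QuantumFieldTheory.Balaban1983to89
open Finset B6RandomWalk B6RandomWalkHom B9Thm37Sum B9Thm34Ext B9Thm37Glue B9Thm37Whole B9Cor38Whole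
open B9RWSums343to347Whole B9RWSums346Schur B9Thm37GlueCor36 B9RWSums343Holder B9RWSums343HolderGp B9RWSums346Lap
open B9RWSums344Input B9RWSums344InputGp B9RWSums346Two B9RWSums346TwoGp B11SectG B9Thm37AllNorms B9SectDL2Decay B9RWSums346SecondDiff
open B9RWSums346SecondDiffGp B9Thm37WholeDir B9Thm37KLetterDir B9RWSums346SecondDiffGpDir

noncomputable section

/-! ## §1 The a-priori constant block bound of a linear map of finite lattices -/

section APriori

variable {g : B9.Geometry} [Fintype g.Site] {R : ℝ} {H : Prop} {X Z : Type} [Fintype X] [Fintype Z]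

/-- **EVERY LINEAR MAP OF FINITE LATTICES HAS A CONSTANT BLOCK-`L²` BOUND** (`M₀ = ` the Frobenius norm of its matrix; Cauchy–Schwarz row by row) — the a-priori input
`hap` of `B11SectG.neumann_majorant` (in print: the norm convergence of the Neumann series (3.90) ∕ [B11] (188)).
[cite: Balaban1985BackgroundPropagators, (3.90) p.409 («convergent in all norms»); Balaban1985Variational, (187)–(188) p.308, bookkeeping] -/
theorem exists_blockBd_const (blk₁ : X → g.Site) (blk₂ : Z → g.Site) (T : (X → ℝ) →ₗ[ℝ] (Z → ℝ)) :
    ∃ M₀ : ℝ, 0 ≤ M₀ ∧ BlockBd (g := toB6 g R H) blk₁ blk₂ T (fun _ _ => M₀) := by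
  classical
  refine ⟨Real.sqrt (∑ z : Z, ∑ x : X, (LinearMap.toMatrix' T z x) ^ 2), Real.sqrt_nonneg _, ?_⟩
  intro y' μ hμ y
  have hmv : ∀ z, T μ z = ∑ x, LinearMap.toMatrix' T z x * μ x := by
    intro z
    have h := LinearMap.toMatrix'_mulVec T μ
    rw [← h]
    rfl
  -- ‖μ‖² on the whole lattice is its block size at `y′`
  have hμsq : ∑ x, μ x ^ 2 = bsq (g := toB6 g R H) blk₁ y' μ := by
    unfold bsq
    refine Finset.sum_congr rfl fun x _ => ?_
    split_ifs with hx
    · rfl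
    · rw [hμ x hx]; ring
  have hF0 : 0 ≤ ∑ z : Z, ∑ x : X, (LinearMap.toMatrix' T z x) ^ 2 := Finset.sum_nonneg fun z _ => Finset.sum_nonneg fun x _ => sq_nonneg _
  have hrow : ∀ z, (T μ z) ^ 2 ≤ (∑ x, (LinearMap.toMatrix' T z x) ^ 2) * ∑ x, μ x ^ 2 := by
    intro z
    rw [hmv z]
    exact Finset.sum_mul_sq_le_sq_mul_sq _ _ _
  have hbsq : bsq (g := toB6 g R H) blk₂ y (T μ) ≤ (∑ z : Z, ∑ x : X, (LinearMap.toMatrix' T z x) ^ 2) * bsq (g := toB6 g R H) blk₁ y' μ := by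
    rw [← hμsq]
    calc bsq (g := toB6 g R H) blk₂ y (T μ) ≤ ∑ z, (T μ z) ^ 2 := by
          unfold bsq
          exact Finset.sum_le_sum fun z _ => by
            split_ifs
            · exact le_rfl
            · exact sq_nonneg _
      _ ≤ ∑ z, (∑ x, (LinearMap.toMatrix' T z x) ^ 2) * ∑ x, μ x ^ 2 := Finset.sum_le_sum fun z _ => hrow z
      _ = (∑ z : Z, ∑ x : X, (LinearMap.toMatrix' T z x) ^ 2) * ∑ x, μ x ^ 2 := by rw [Finset.sum_mul]
  unfold bl2
  calc Real.sqrt (bsq (g := toB6 g R H) blk₂ y (T μ)) ≤ Real.sqrt ((∑ z : Z, ∑ x : X, (LinearMap.toMatrix' T z x) ^ 2) * bsq (g := toB6 g R H) blk₁ y' μ) :=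
        Real.sqrt_le_sqrt hbsq
    _ = Real.sqrt (∑ z : Z, ∑ x : X, (LinearMap.toMatrix' T z x) ^ 2) * Real.sqrt (bsq (g := toB6 g R H) blk₁ y' μ) := Real.sqrt_mul hF0 _

end APriori

/-! ## §2 The sixth and fourth `L²` members of (3.46) for `G′` by the LEFT Neumann series -/

section GpSide

variable {g : B9.Geometry} [Fintype g.Site] [DecidableEq g.Site] {R : ℝ} {H : Prop} {B : B9.Backgrounds}
variable {X Y ι P : Type} [Fintype P]

omit [Fintype g.Site] [DecidableEq g.Site] [Fintype P] in
/-- Algebra of the transposed (3.88) read through an operator on the right: `G′ = G′₀ + V·G′` gives `G′∘E = G′₀∘E + V∘(G′∘E)`. [folklore] -/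
private theorem left_split {Y' : Type} {E : (Y' → ℝ) →ₗ[ℝ] (X → ℝ)} {G G0 V : Module.End ℝ (X → ℝ)} (h : G = G0 + V * G) :
    G ∘ₗ E = G0 ∘ₗ E + V ∘ₗ (G ∘ₗ E) := by
  conv_lhs => rw [h]
  apply LinearMap.ext
  intro μ
  simp only [LinearMap.comp_apply, LinearMap.add_apply, Module.End.mul_apply]

/-- ★★ **THE SIXTH `L²` MEMBER OF (3.46) FOR THE SUM `G′(U)`, PER DIRECTION PAIR, BY THE LEFT NEUMANN SERIES** — no third-order factor: from the head legs
`h_□G′_□h_□∇\*_ν∇\*_μ` (Cor 3.6, schema `L2SecondLegs37`, summed with the overlap `N₃`), an `L²` block bound `θ_V·e^{−δ₁d(y,y′)}` of the transposed walk kernel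
`V = Σ_□ h_□G′_□K(h_□)ᵗ` with the smallness `θ_V·c₁(α₁) ≤ ½` (print's «M sufficiently large»), the transposed (3.88) `G′ = G′₀ + V·G′` (`fixedPointT_dir`), and [4] Lemma 2.1
(2.61) at `(δ₁, α₁)` with the triangle inequality (2.54): `‖1_{Δ(y)}G′∇\*_ν∇\*_μλ‖₂ ≤ 2N₃B₃·e^{−(1−α₁)δ₁d(y,y′)}‖λ‖₂` for `supp λ ⊂ Δ(y′)` — `G′∇\*∇\* = Σₙ Vⁿ(G′₀∇\*∇\*)`, the
`n`-th term of majorant `(θ_Vc₁)ⁿN₃B₃e^{−(1−α₁)δ₁d}`, the remainder killed by the a-priori bound of §1 (`B11SectG.neumann_majorant`, sharp blocks `κ = 1`).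
[cite: Balaban1985BackgroundPropagators, Thm 3.7 (3.87)–(3.90) pp.408–410 + (3.46) p.398 + p.391; Balaban1984PropagatorsII, (2.52)–(2.55) pp.232–233 + Lemma 2.1 (2.61) p.234; Balaban1985Variational, (188) p.308] -/
theorem l2line5_left_of_blockBd [Fintype X] [DecidableEq X] [Fintype ι]
    (𝔬 : Ops g B X Y ι) (𝔡 : DirOps37 𝔬 P) (𝔩 : DirLetters37 𝔬 P) (R : ℝ) (H : Prop) (d₁ : ℕ) (δ₁ α₁ ρ N N' Cℓ N3 B3 θV : ℝ) (κ : Sizes)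
    (S3 : ι → Finset g.Site) (U : B.Cfg)
    (hN3 : 0 ≤ N3) (hB3 : 0 ≤ B3) (hθV : 0 ≤ θV) (hα₁δ₁ : 0 ≤ α₁ * δ₁) (hα₁δ₁' : α₁ * δ₁ ≤ δ₁)
    (hs : StaticOK 𝔬 ρ N N' Cℓ κ) (hcnt3 : ∀ a : g.Site, (∑ i, if a ∈ S3 i then (1 : ℝ) else 0) ≤ N3)
    (h261 : Ineq261 d₁ (toB6 g R H) δ₁ α₁) (hi : Identities₂ 𝔬 𝔡 𝔩 R H U)
    (hL : L2SecondLegs37 𝔬 𝔡 R H S3 B3 δ₁ U)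
    (hV : BlockBd (g := toB6 g R H) 𝔬.blk 𝔬.blk (VDir 𝔬 𝔡 𝔩 U) (fun (a b : g.Site) => θV * Real.exp (-(δ₁ * g.dist a b))))
    (hsmall : θV * B6.c1 d₁ δ₁ α₁ ≤ 1 / 2) (ν μ : P) :
    BlockBd (g := toB6 g R H) 𝔬.blk 𝔬.blk (𝔬.Gp U ∘ₗ (𝔡.Dsd U ν ∘ₗ 𝔡.Dsd U μ))
      (fun (a b : g.Site) => 2 * (N3 * B3) * Real.exp (-((1 - α₁) * δ₁ * g.dist a b))) := by
  have htri : Triangle254 (toB6 g R H) := fun a b c => hs.tri a b c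
  have hdnn : ∀ a b : (toB6 g R H).Site, 0 ≤ (toB6 g R H).dist a b := fun a b => hs.dnn a b
  have hrow : RowSum (toB6 g R H) (α₁ * δ₁) (B6.c1 d₁ δ₁ α₁) := (rowSum_iff_ineq261 d₁ (toB6 g R H) δ₁ α₁).mp h261
  have hρ0 : 0 ≤ (1 - α₁) * δ₁ := by nlinarith
  -- the transposed (3.88), read through `∇*_ν∇*_μ`
  have hfix := left_split (E := 𝔡.Dsd U ν ∘ₗ 𝔡.Dsd U μ) (fixedPointT_dir hi)
  -- the head legs, summed with the overlap count, then weakened to the rate `(1 − α₁)δ₁`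
  have hsumE : (∑ i, mulOp (𝔬.h i) * 𝔬.Gsq U i * mulOp (𝔬.h i)) ∘ₗ (𝔡.Dsd U ν ∘ₗ 𝔡.Dsd U μ) =
      ∑ i, (mulOp (𝔬.h i) * 𝔬.Gsq U i * mulOp (𝔬.h i)) ∘ₗ (𝔡.Dsd U ν ∘ₗ 𝔡.Dsd U μ) := by
    apply LinearMap.ext
    intro f
    simp only [LinearMap.comp_apply, LinearMap.sum_apply]
  have hhead := blockBd_localSum (R := R) (H := H) 𝔬.blk 𝔬.blk
    (fun i => (mulOp (𝔬.h i) * 𝔬.Gsq U i * mulOp (𝔬.h i)) ∘ₗ (𝔡.Dsd U ν ∘ₗ 𝔡.Dsd U μ))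
    (fun i (a : g.Site) => if a ∈ S3 i then (1 : ℝ) else 0) (fun (a b : g.Site) => B3 * Real.exp (-(δ₁ * g.dist a b))) N3
    (fun a b => mul_nonneg hB3 (Real.exp_nonneg _)) (fun i => hL.l5 i ν μ) hcnt3
  rw [← hsumE] at hhead
  have hS : BlockBd (g := toB6 g R H) 𝔬.blk 𝔬.blk ((∑ i, mulOp (𝔬.h i) * 𝔬.Gsq U i * mulOp (𝔬.h i)) ∘ₗ (𝔡.Dsd U ν ∘ₗ 𝔡.Dsd U μ))
      (fun (a b : g.Site) => N3 * B3 * Real.exp (-((1 - α₁) * δ₁ * (toB6 g R H).dist a b))) := by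
    refine hhead.mono fun a b => ?_
    have hexp : Real.exp (-(δ₁ * g.dist a b)) ≤ Real.exp (-((1 - α₁) * δ₁ * g.dist a b)) :=
      Real.exp_le_exp.mpr (neg_le_neg (mul_le_mul_of_nonneg_right (by nlinarith) (hs.dnn a b)))
    calc N3 * (B3 * Real.exp (-(δ₁ * g.dist a b))) = N3 * B3 * Real.exp (-(δ₁ * g.dist a b)) := by ring
      _ ≤ N3 * B3 * Real.exp (-((1 - α₁) * δ₁ * g.dist a b)) := mul_le_mul_of_nonneg_left hexp (mul_nonneg hN3 hB3)
      _ = N3 * B3 * Real.exp (-((1 - α₁) * δ₁ * (toB6 g R H).dist a b)) := by simp only [toB6_dist]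
  have hV' : BlockBd (g := toB6 g R H) 𝔬.blk 𝔬.blk (VDir 𝔬 𝔡 𝔩 U) (fun (a b : g.Site) => θV * Real.exp (-(δ₁ * (toB6 g R H).dist a b))) :=
    hV.mono fun a b => by simp only [toB6_dist]; exact le_rfl
  -- the a-priori bound and the Neumann series over the sharp block-L² norms
  obtain ⟨M₀, hM₀, hap⟩ := exists_blockBd_const (g := g) (R := R) (H := H) 𝔬.blk 𝔬.blk (𝔬.Gp U ∘ₗ (𝔡.Dsd U ν ∘ₗ 𝔡.Dsd U μ))
  rw [blockBd_iff_hasMaj] at hS hV' hap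
  have hq : (l2w (toB6 g R H) 𝔬.blk (fun _ => (1 : ℝ)) (fun _ => zero_le_one)).κ * θV * B6.c1 d₁ δ₁ α₁ < 1 := by
    rw [l2w_κ, one_mul]; linarith
  have hN := neumann_majorant (b₁ := l2w (toB6 g R H) 𝔬.blk (fun _ => (1 : ℝ)) (fun _ => zero_le_one))
    (b₂ := l2w (toB6 g R H) 𝔬.blk (fun _ => (1 : ℝ)) (fun _ => zero_le_one)) htri hdnn hrow hθV (mul_nonneg hN3 hB3) hM₀ hρ0 (by linarith)
    hV' hS hfix hap hq
  rw [blockBd_iff_hasMaj]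
  refine hN.mono fun a b => ?_
  rw [l2w_κ, one_mul]
  have hinv : (1 - θV * B6.c1 d₁ δ₁ α₁)⁻¹ ≤ 2 := by
    rw [inv_le_comm₀ (by linarith) (by norm_num : (0 : ℝ) < 2)]
    linarith
  have hK0 : 0 ≤ N3 * B3 := mul_nonneg hN3 hB3
  calc N3 * B3 * (1 - θV * B6.c1 d₁ δ₁ α₁)⁻¹ * Real.exp (-((1 - α₁) * δ₁ * (toB6 g R H).dist a b))
      ≤ N3 * B3 * 2 * Real.exp (-((1 - α₁) * δ₁ * (toB6 g R H).dist a b)) :=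
        mul_le_mul_of_nonneg_right (mul_le_mul_of_nonneg_left hinv hK0) (Real.exp_nonneg _)
    _ = 2 * (N3 * B3) * Real.exp (-((1 - α₁) * δ₁ * g.dist a b)) := by simp only [toB6_dist]; ring

/-- ★ **THE FOURTH `L²` MEMBER OF (3.46) FOR THE SUM `G′(U)`, PER DIRECTION PAIR, BY ADJOINT TRANSFER** from the left-series sixth member — `∇_ν∇_μG′ = (G′∇\*_μ∇\*_ν)ᵀ`
(`G′` symmetric, `∇\*_κ = ∇_κᵀ`), `B9SectDL2Decay.blockBd_of_adjoint`. [cite: Balaban1985BackgroundPropagators, (3.46) p.398 (fourth member) + p.398 ll.28–31 + p.391] -/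
theorem l2line3_left_of_blockBd [Fintype X] [DecidableEq X] [Fintype ι]
    (𝔬 : Ops g B X Y ι) (𝔡 : DirOps37 𝔬 P) (𝔩 : DirLetters37 𝔬 P) (R : ℝ) (H : Prop) (d₁ : ℕ) (δ₁ α₁ ρ N N' Cℓ N3 B3 θV : ℝ) (κ : Sizes)
    (S3 : ι → Finset g.Site) (U : B.Cfg)
    (hN3 : 0 ≤ N3) (hB3 : 0 ≤ B3) (hθV : 0 ≤ θV) (hα₁δ₁ : 0 ≤ α₁ * δ₁) (hα₁δ₁' : α₁ * δ₁ ≤ δ₁)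
    (hs : StaticOK 𝔬 ρ N N' Cℓ κ) (hcnt3 : ∀ a : g.Site, (∑ i, if a ∈ S3 i then (1 : ℝ) else 0) ≤ N3)
    (h261 : Ineq261 d₁ (toB6 g R H) δ₁ α₁) (hi : Identities₂ 𝔬 𝔡 𝔩 R H U)
    (hL : L2SecondLegs37 𝔬 𝔡 R H S3 B3 δ₁ U)
    (hV : BlockBd (g := toB6 g R H) 𝔬.blk 𝔬.blk (VDir 𝔬 𝔡 𝔩 U) (fun (a b : g.Site) => θV * Real.exp (-(δ₁ * g.dist a b))))
    (hsmall : θV * B6.c1 d₁ δ₁ α₁ ≤ 1 / 2) (hDT : DirTranspose37 𝔬 𝔡 U) (hsym : IsTransposePair (𝔬.Gp U) (𝔬.Gp U)) (ν μ : P) :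
    BlockBd (g := toB6 g R H) 𝔬.blk 𝔬.blk ((𝔡.Dd U ν ∘ₗ 𝔡.Dd U μ) ∘ₗ 𝔬.Gp U)
      (fun (a b : g.Site) => 2 * (N3 * B3) * Real.exp (-((1 - α₁) * δ₁ * g.dist a b))) := by
  have h5 := l2line5_left_of_blockBd 𝔬 𝔡 𝔩 R H d₁ δ₁ α₁ ρ N N' Cℓ N3 B3 θV κ S3 U hN3 hB3 hθV hα₁δ₁ hα₁δ₁' hs hcnt3 h261 hi hL hV hsmall μ ν
  have hK : 0 ≤ 2 * (N3 * B3) := by positivity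
  have hadj : IsTransposePair (𝔬.Gp U ∘ₗ (𝔡.Dsd U μ ∘ₗ 𝔡.Dsd U ν)) ((𝔡.Dd U ν ∘ₗ 𝔡.Dd U μ) ∘ₗ 𝔬.Gp U) :=
    ((hDT.tr ν).comp (hDT.tr μ)).comp hsym
  have h := blockBd_of_adjoint (g := toB6 g R H) (blk₁ := 𝔬.blk) (blk₂ := 𝔬.blk) (T := (𝔡.Dd U ν ∘ₗ 𝔡.Dd U μ) ∘ₗ 𝔬.Gp U)
    (T' := 𝔬.Gp U ∘ₗ (𝔡.Dsd U μ ∘ₗ 𝔡.Dsd U ν)) (fun u w => by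
      rw [dotProduct, dotProduct]
      exact (hadj u w).symm) h5 (fun y y' => mul_nonneg hK (Real.exp_nonneg _))
  refine h.mono fun y y' => ?_
  rw [hs.symm y' y]

/-! ## §3 The block bound of `V` from Corollary 3.6's sup majorants (Schur) -/

omit [Fintype g.Site] [DecidableEq g.Site] in
/-- `V = Σ_□ h_□G′_□K(h_□)ᵗ` and `R′ = Σ_□ K(h_□)G′_□h_□` ARE A TRANSPOSE PAIR for the component pairing, given the letter-level transposes `∇\*_μ = ∇_μᵀ` (`DirTranspose37`),
`Pᵗ_{□,μ} = P_{□,μ}ᵀ`, `Cᵗ_□ = C_□ᵀ` and the symmetry of the local inverses `G′_□` (p. 391: the adjoints are `L²` adjoints). [cite: Balaban1985BackgroundPropagators, (3.88) p.409 + p.391] -/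
theorem isTransposePair_VDir_RprimeDir [Fintype X] [Fintype ι] (𝔬 : Ops g B X Y ι) (𝔡 : DirOps37 𝔬 P) (𝔩 : DirLetters37 𝔬 P) (U : B.Cfg)
    (hDT : DirTranspose37 𝔬 𝔡 U) (hGsqT : ∀ i, IsTransposePair (𝔬.Gsq U i) (𝔬.Gsq U i)) (hPt : ∀ i μ, IsTransposePair (𝔩.Pt U i μ) (𝔩.P U i μ))
    (hCt : ∀ i, IsTransposePair (𝔬.Ct U i) (𝔬.Cop U i)) :
    IsTransposePair (VDir 𝔬 𝔡 𝔩 U) (RprimeDir 𝔬 𝔡 𝔩 U) := by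
  unfold VDir RprimeDir
  refine IsTransposePair.sum fun i => ?_
  have hK : IsTransposePair (KoptDir 𝔬 𝔡 𝔩 U i) (KopDir 𝔬 𝔡 𝔩 U i) := by
    unfold KoptDir KopDir
    exact (IsTransposePair.sum fun μ => (hDT.tr μ).mul (hPt i μ)).add (hCt i)
  have h3 : IsTransposePair (mulOp (𝔬.h i) * 𝔬.Gsq U i * KoptDir 𝔬 𝔡 𝔩 U i) (KopDir 𝔬 𝔡 𝔩 U i * (𝔬.Gsq U i * mulOp (𝔬.h i))) :=
    ((isTransposePair_mulOp (𝔬.h i)).mul (hGsqT i)).mul hK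
  exact h3.congr_right (by rw [mul_assoc])

/-- ★★ **THE `L²` BLOCK BOUND OF THE TRANSPOSED WALK KERNEL `V` FROM COROLLARY 3.6's SUP MAJORANTS** (the hypothesis `hV` of §2, DISCHARGED from letters the certificate
already displays): the sup majorants `N′A_V·(Lʲη)(L^{j′}η)⁻¹e^{−δ₀d}` of `V` (`B9Thm37KLetterDir.hV_dir`: Cor 3.6 `Local342` + the per-direction entries `DirSupSq37` + the
coefficient majorants of `Identities₂`) and `N′A_R·e^{−δ₀d}` of its transpose `R′` (`hR_dir`), the Schur test (`B9RWSums346Schur.blockBd_schur`) and p. 398's scale transfer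
(`(Lʲη∕L^{j′}η)·e^{−αδd} ≤ L ≤ L₀`, `scaleTransfer_len_rpow` under the member facts `Facts347 … δ α L₀`) give
`BlockBd blk blk V (N′·√(A_V·A_R·L₀)·e^{−(δ₀ − αδ)d(y,y′)})`, `A_V = B₀e^{δ₀ρ}(k_{Pᵗ} + C_ℓk_{Cᵗ})`, `A_R = B₀e^{δ₀ρ}(k_P + k_C)` — print's `O(M⁻¹)` ((3.89)).
[cite: Balaban1985BackgroundPropagators, (3.88)–(3.89) p.409, Cor 3.6 p.408, (3.46)∕(3.42) pp.397–398 + p.398 remark after (3.47) + p.391; Balaban1984PropagatorsII, (2.39)–(2.44) pp.229–230, Lemma 2.1 (2.60) p.234] -/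
theorem blockBd_VDir_of_local342 [Fintype X] [Fintype Y] [Fintype ι] (𝔬 : Ops g B X Y ι) (𝔡 : DirOps37 𝔬 P) (𝔩 : DirLetters37 𝔬 P) (U : B.Cfg)
    {d : ℕ} {δ α L₀ ρ N N' Cℓ B₀ δ₀ : ℝ} {κ : Sizes} (hF : Facts347 g R H d δ α L₀) (hαδ : 0 ≤ α * δ) (hB₀ : 0 ≤ B₀) (hδ₀ : 0 ≤ δ₀) (hCℓ : 0 ≤ Cℓ) (hN' : 0 ≤ N')
    (hκ : κ.Nonneg) (hs : StaticOK 𝔬 ρ N N' Cℓ κ) (hl : Local342 𝔬 R H B₀ δ₀ U) (hT : DirSupSq37 𝔬 𝔡 R H U) (hi : Identities₂ 𝔬 𝔡 𝔩 R H U)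
    (hDT : DirTranspose37 𝔬 𝔡 U) (hGsqT : ∀ i, IsTransposePair (𝔬.Gsq U i) (𝔬.Gsq U i)) (hPt : ∀ i μ, IsTransposePair (𝔩.Pt U i μ) (𝔩.P U i μ))
    (hCt : ∀ i, IsTransposePair (𝔬.Ct U i) (𝔬.Cop U i)) :
    BlockBd (g := toB6 g R H) 𝔬.blk 𝔬.blk (VDir 𝔬 𝔡 𝔩 U)
      (fun (a b : g.Site) => N' * Real.sqrt ((B₀ * Real.exp (δ₀ * ρ) * (κ.kPt + Cℓ * κ.kCt)) * (B₀ * Real.exp (δ₀ * ρ) * (κ.kP + κ.kC)) * L₀)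
        * Real.exp (-((δ₀ - α * δ) * g.dist a b))) := by
  have hlen : ∀ y : g.Site, 0 < g.len y := hs.lenpos
  have hAV : 0 ≤ B₀ * Real.exp (δ₀ * ρ) * (κ.kPt + Cℓ * κ.kCt) :=
    mul_nonneg (mul_nonneg hB₀ (Real.exp_nonneg _)) (add_nonneg hκ.kPt (mul_nonneg hCℓ hκ.kCt))
  have hAR : 0 ≤ B₀ * Real.exp (δ₀ * ρ) * (κ.kP + κ.kC) := mul_nonneg (mul_nonneg hB₀ (Real.exp_nonneg _)) (add_nonneg hκ.kP hκ.kC)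
  have hKV : ∀ a b : g.Site, 0 ≤ N' * (B₀ * Real.exp (δ₀ * ρ) * (κ.kPt + Cℓ * κ.kCt)) * g.len a * (g.len b)⁻¹ * Real.exp (-(δ₀ * g.dist a b)) :=
    fun a b => mul_nonneg (mul_nonneg (mul_nonneg (mul_nonneg hN' hAV) (hlen a).le) (inv_nonneg.2 (hlen b).le)) (Real.exp_nonneg _)
  have hKR : ∀ a b : g.Site, 0 ≤ N' * (B₀ * Real.exp (δ₀ * ρ) * (κ.kP + κ.kC)) * Real.exp (-(δ₀ * g.dist a b)) :=
    fun a b => mul_nonneg (mul_nonneg hN' hAR) (Real.exp_nonneg _)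
  have hVm := (hasMajorantHom_iff (g := toB6 g R H) 𝔬.blk (VDir 𝔬 𝔡 𝔩 U) _).mpr (hV_dir (R := R) (H := H) hB₀ hδ₀ hCℓ hκ hs hl hT hi)
  have hRm := (hasMajorantHom_iff (g := toB6 g R H) 𝔬.blk (RprimeDir 𝔬 𝔡 𝔩 U) _).mpr (hR_dir (R := R) (H := H) hB₀ hδ₀ hκ hs hl hT hi)
  have hS := blockBd_schur (G := toB6 g R H) 𝔬.blk 𝔬.blk hKV hKR hVm hRm (isTransposePair_VDir_RprimeDir 𝔬 𝔡 𝔩 U hDT hGsqT hPt hCt)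
  refine hS.mono fun (y : g.Site) (y' : g.Site) => ?_
  -- the product of the two kernels is ≤ (N′·√(A_V A_R L₀)·e^{−(δ₀−αδ)d})²
  set AV : ℝ := B₀ * Real.exp (δ₀ * ρ) * (κ.kPt + Cℓ * κ.kCt) with hAVdef
  set AR : ℝ := B₀ * Real.exp (δ₀ * ρ) * (κ.kP + κ.kC) with hARdef
  have hL1 : 1 ≤ g.L := hF.one_le_L
  have hL₀ : g.L ≤ L₀ := hF.L_le
  have htr : Real.exp (-(α * δ * g.dist y y')) * g.len y' ^ (-1 : ℝ) ≤ g.L ^ |(-1 : ℝ)| * g.len y ^ (-1 : ℝ) :=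
    scaleTransfer_len_rpow hF (-1) (by rw [abs_neg, abs_one]; norm_num) y y'
  rw [abs_neg, abs_one, Real.rpow_one, Real.rpow_neg_one, Real.rpow_neg_one] at htr
  -- `(Lʲη∕L^{j′}η)·e^{−αδd} ≤ L`
  have hratio : g.len y * (g.len y')⁻¹ * Real.exp (-(α * δ * g.dist y y')) ≤ g.L := by
    have hy : g.len y ≠ 0 := (hlen y).ne'
    have h1 : g.len y * (Real.exp (-(α * δ * g.dist y y')) * (g.len y')⁻¹) ≤ g.len y * (g.L * (g.len y)⁻¹) :=
      mul_le_mul_of_nonneg_left htr (hlen y).le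
    have h2 : g.len y * (g.L * (g.len y)⁻¹) = g.L := by field_simp
    calc g.len y * (g.len y')⁻¹ * Real.exp (-(α * δ * g.dist y y')) = g.len y * (Real.exp (-(α * δ * g.dist y y')) * (g.len y')⁻¹) := by ring
      _ ≤ g.L := by rw [← h2]; exact h1
  have hdsym : g.dist y' y = g.dist y y' := hs.symm y' y
  have hL₀0 : 0 ≤ L₀ := le_trans (zero_le_one.trans hL1) hL₀
  have htarget0 : 0 ≤ N' * Real.sqrt (AV * AR * L₀) * Real.exp (-((δ₀ - α * δ) * g.dist y y')) := by positivity
  have hexp1 : Real.exp (-(α * δ * g.dist y y')) ≤ 1 := by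
    rw [Real.exp_le_one_iff]
    have := hs.dnn y y'
    nlinarith
  have hkey : g.len y * (g.len y')⁻¹ * Real.exp (-(α * δ * g.dist y y')) ^ 2 ≤ L₀ := by
    calc g.len y * (g.len y')⁻¹ * Real.exp (-(α * δ * g.dist y y')) ^ 2
        = (g.len y * (g.len y')⁻¹ * Real.exp (-(α * δ * g.dist y y'))) * Real.exp (-(α * δ * g.dist y y')) := by ring
      _ ≤ g.L * 1 := mul_le_mul hratio hexp1 (Real.exp_nonneg _) (zero_le_one.trans hL1)
      _ ≤ L₀ := by rw [mul_one]; exact hL₀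
  have hE : Real.exp (-(δ₀ * g.dist y y')) = Real.exp (-(α * δ * g.dist y y')) * Real.exp (-((δ₀ - α * δ) * g.dist y y')) := by
    rw [← Real.exp_add]; congr 1; ring
  have hprod : (N' * AV * g.len y * (g.len y')⁻¹ * Real.exp (-(δ₀ * g.dist y y'))) * (N' * AR * Real.exp (-(δ₀ * g.dist y' y)))
      ≤ (N' * Real.sqrt (AV * AR * L₀) * Real.exp (-((δ₀ - α * δ) * g.dist y y'))) ^ 2 := by
    have hsq : (N' * Real.sqrt (AV * AR * L₀) * Real.exp (-((δ₀ - α * δ) * g.dist y y'))) ^ 2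
        = N' ^ 2 * (AV * AR * L₀) * Real.exp (-((δ₀ - α * δ) * g.dist y y')) ^ 2 := by
      rw [mul_pow, mul_pow, Real.sq_sqrt (by positivity)]
    rw [hdsym, hsq, hE]
    have hnn : 0 ≤ N' ^ 2 * (AV * AR) * Real.exp (-((δ₀ - α * δ) * g.dist y y')) ^ 2 := by positivity
    calc N' * AV * g.len y * (g.len y')⁻¹ * (Real.exp (-(α * δ * g.dist y y')) * Real.exp (-((δ₀ - α * δ) * g.dist y y')))
          * (N' * AR * (Real.exp (-(α * δ * g.dist y y')) * Real.exp (-((δ₀ - α * δ) * g.dist y y'))))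
        = (g.len y * (g.len y')⁻¹ * Real.exp (-(α * δ * g.dist y y')) ^ 2) * (N' ^ 2 * (AV * AR) * Real.exp (-((δ₀ - α * δ) * g.dist y y')) ^ 2) := by ring
      _ ≤ L₀ * (N' ^ 2 * (AV * AR) * Real.exp (-((δ₀ - α * δ) * g.dist y y')) ^ 2) := mul_le_mul_of_nonneg_right hkey hnn
      _ = N' ^ 2 * (AV * AR * L₀) * Real.exp (-((δ₀ - α * δ) * g.dist y y')) ^ 2 := by ring
  calc Real.sqrt ((N' * AV * g.len y * (g.len y')⁻¹ * Real.exp (-(δ₀ * (toB6 g R H).dist y y'))) * (N' * AR * Real.exp (-(δ₀ * (toB6 g R H).dist y' y))))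
      ≤ Real.sqrt ((N' * Real.sqrt (AV * AR * L₀) * Real.exp (-((δ₀ - α * δ) * g.dist y y'))) ^ 2) := by
        simp only [toB6_dist]; exact Real.sqrt_le_sqrt hprod
    _ = N' * Real.sqrt (AV * AR * L₀) * Real.exp (-((δ₀ - α * δ) * g.dist y y')) := Real.sqrt_sq htarget0

/-! ## §4 The drop-in forms: Corollary 3.6's letters in, the two families out -/

/-- ★★★ **THE SIXTH `L²` MEMBER OF (3.46) FOR `G′(U)` FROM COROLLARY 3.6's LETTERS ALONE — NO FACTOR SCHEMA**: §2 fed by §3.  Hypotheses: the head legs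
`L2SecondLegs37` (`B₃`, rate `δ₁`), Cor 3.6's sup majorants `Local342 … B₀ δ₀`, the per-direction entries `DirSupSq37`, the transposed (3.88) and the coefficient majorants
(`Identities₂`), the letter transposes, the member facts `Facts347 … δ α L₀` with `δ₁ ≤ δ₀ − αδ`, [4] (2.61) at `(δ₁, α₁)`, and the smallness
`N′·√(A_V·A_R·L₀)·c₁(α₁) ≤ ½` («M sufficiently large»: `A_V, A_R = O(M⁻¹)` by `Sizes.Bounded`).  Conclusion: `BlockBd blk blk (G′ ∘ (∇\*_ν ∘ ∇\*_μ)) (2N₃B₃·e^{−(1−α₁)δ₁d})`.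
[cite: Balaban1985BackgroundPropagators, Thm 3.7 (3.87)–(3.90) pp.408–410, Cor 3.6 p.408, (3.46) p.398, p.391; Balaban1984PropagatorsII, (2.52)–(2.55) pp.232–233, Lemma 2.1 (2.60)–(2.61) p.234] -/
theorem l2line5_left_of_local342 [Fintype X] [DecidableEq X] [Fintype Y] [Fintype ι]
    (𝔬 : Ops g B X Y ι) (𝔡 : DirOps37 𝔬 P) (𝔩 : DirLetters37 𝔬 P) (R : ℝ) (H : Prop) (d d₁ : ℕ) (δ α L₀ δ₁ α₁ ρ N N' Cℓ N3 B3 B₀ δ₀ : ℝ) (κ : Sizes)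
    (S3 : ι → Finset g.Site) (U : B.Cfg)
    (hN' : 0 ≤ N') (hN3 : 0 ≤ N3) (hB3 : 0 ≤ B3) (hB₀ : 0 ≤ B₀) (hδ₀ : 0 ≤ δ₀) (hCℓ : 0 ≤ Cℓ) (hκ : κ.Nonneg) (hαδ : 0 ≤ α * δ)
    (hα₁δ₁ : 0 ≤ α₁ * δ₁) (hα₁δ₁' : α₁ * δ₁ ≤ δ₁) (hδ₁ : δ₁ ≤ δ₀ - α * δ)
    (hs : StaticOK 𝔬 ρ N N' Cℓ κ) (hcnt3 : ∀ a : g.Site, (∑ i, if a ∈ S3 i then (1 : ℝ) else 0) ≤ N3)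
    (h261 : Ineq261 d₁ (toB6 g R H) δ₁ α₁) (hF : Facts347 g R H d δ α L₀) (hi : Identities₂ 𝔬 𝔡 𝔩 R H U)
    (hl : Local342 𝔬 R H B₀ δ₀ U) (hT : DirSupSq37 𝔬 𝔡 R H U) (hL : L2SecondLegs37 𝔬 𝔡 R H S3 B3 δ₁ U)
    (hDT : DirTranspose37 𝔬 𝔡 U) (hGsqT : ∀ i, IsTransposePair (𝔬.Gsq U i) (𝔬.Gsq U i)) (hPt : ∀ i μ, IsTransposePair (𝔩.Pt U i μ) (𝔩.P U i μ))
    (hCt : ∀ i, IsTransposePair (𝔬.Ct U i) (𝔬.Cop U i))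
    (hsmall : N' * Real.sqrt ((B₀ * Real.exp (δ₀ * ρ) * (κ.kPt + Cℓ * κ.kCt)) * (B₀ * Real.exp (δ₀ * ρ) * (κ.kP + κ.kC)) * L₀) * B6.c1 d₁ δ₁ α₁ ≤ 1 / 2)
    (ν μ : P) :
    BlockBd (g := toB6 g R H) 𝔬.blk 𝔬.blk (𝔬.Gp U ∘ₗ (𝔡.Dsd U ν ∘ₗ 𝔡.Dsd U μ))
      (fun (a b : g.Site) => 2 * (N3 * B3) * Real.exp (-((1 - α₁) * δ₁ * g.dist a b))) := by
  have hV0 := blockBd_VDir_of_local342 (R := R) (H := H) 𝔬 𝔡 𝔩 U hF hαδ hB₀ hδ₀ hCℓ hN' hκ hs hl hT hi hDT hGsqT hPt hCt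
  have hθ : 0 ≤ N' * Real.sqrt ((B₀ * Real.exp (δ₀ * ρ) * (κ.kPt + Cℓ * κ.kCt)) * (B₀ * Real.exp (δ₀ * ρ) * (κ.kP + κ.kC)) * L₀) :=
    mul_nonneg hN' (Real.sqrt_nonneg _)
  have hV : BlockBd (g := toB6 g R H) 𝔬.blk 𝔬.blk (VDir 𝔬 𝔡 𝔩 U)
      (fun (a b : g.Site) => N' * Real.sqrt ((B₀ * Real.exp (δ₀ * ρ) * (κ.kPt + Cℓ * κ.kCt)) * (B₀ * Real.exp (δ₀ * ρ) * (κ.kP + κ.kC)) * L₀)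
        * Real.exp (-(δ₁ * g.dist a b))) := by
    refine hV0.mono fun a b => mul_le_mul_of_nonneg_left ?_ hθ
    exact Real.exp_le_exp.mpr (neg_le_neg (mul_le_mul_of_nonneg_right hδ₁ (hs.dnn a b)))
  exact l2line5_left_of_blockBd 𝔬 𝔡 𝔩 R H d₁ δ₁ α₁ ρ N N' Cℓ N3 B3 _ κ S3 U hN3 hB3 hθ hα₁δ₁ hα₁δ₁' hs hcnt3 h261 hi hL hV hsmall ν μ

/-- ★★★ **THE PACKAGED FAMILY `G′∇\*_{U,ν}∇\*_{U,μ}` OVER `P × P` FROM COROLLARY 3.6's LETTERS ALONE** (the drop-in for `blockBd_second_family5_37_dir` with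
`FactorsL2Second37Dir` REMOVED): `|P|·2N₃B₃·e^{−(1−α₁)δ₁d}`. [cite: Balaban1985BackgroundPropagators, (3.46) p.398 + (3.39) p.397 + (3.87)–(3.90) pp.408–410] -/
theorem blockBd_second_family5_left_of_local342 [Fintype X] [DecidableEq X] [Fintype Y] [Fintype ι]
    (𝔬 : Ops g B X Y ι) (𝔡 : DirOps37 𝔬 P) (𝔩 : DirLetters37 𝔬 P) (R : ℝ) (H : Prop) (d d₁ : ℕ) (δ α L₀ δ₁ α₁ ρ N N' Cℓ N3 B3 B₀ δ₀ : ℝ) (κ : Sizes)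
    (S3 : ι → Finset g.Site) (U : B.Cfg)
    (hN' : 0 ≤ N') (hN3 : 0 ≤ N3) (hB3 : 0 ≤ B3) (hB₀ : 0 ≤ B₀) (hδ₀ : 0 ≤ δ₀) (hCℓ : 0 ≤ Cℓ) (hκ : κ.Nonneg) (hαδ : 0 ≤ α * δ)
    (hα₁δ₁ : 0 ≤ α₁ * δ₁) (hα₁δ₁' : α₁ * δ₁ ≤ δ₁) (hδ₁ : δ₁ ≤ δ₀ - α * δ)
    (hs : StaticOK 𝔬 ρ N N' Cℓ κ) (hcnt3 : ∀ a : g.Site, (∑ i, if a ∈ S3 i then (1 : ℝ) else 0) ≤ N3)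
    (h261 : Ineq261 d₁ (toB6 g R H) δ₁ α₁) (hF : Facts347 g R H d δ α L₀) (hi : Identities₂ 𝔬 𝔡 𝔩 R H U)
    (hl : Local342 𝔬 R H B₀ δ₀ U) (hT : DirSupSq37 𝔬 𝔡 R H U) (hL : L2SecondLegs37 𝔬 𝔡 R H S3 B3 δ₁ U)
    (hDT : DirTranspose37 𝔬 𝔡 U) (hGsqT : ∀ i, IsTransposePair (𝔬.Gsq U i) (𝔬.Gsq U i)) (hPt : ∀ i μ, IsTransposePair (𝔩.Pt U i μ) (𝔩.P U i μ))
    (hCt : ∀ i, IsTransposePair (𝔬.Ct U i) (𝔬.Cop U i))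
    (hsmall : N' * Real.sqrt ((B₀ * Real.exp (δ₀ * ρ) * (κ.kPt + Cℓ * κ.kCt)) * (B₀ * Real.exp (δ₀ * ρ) * (κ.kP + κ.kC)) * L₀) * B6.c1 d₁ δ₁ α₁ ≤ 1 / 2) :
    BlockBd (g := toB6 g R H) 𝔬.blk (𝔬.blk ∘ Prod.fst)
      (familyOp fun p : P × P => 𝔬.Gp U ∘ₗ (𝔡.Dsd U p.1 ∘ₗ 𝔡.Dsd U p.2))
      (fun (a b : g.Site) => (Fintype.card P : ℝ) * (2 * (N3 * B3)) * Real.exp (-((1 - α₁) * δ₁ * g.dist a b))) := by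
  have hK : 0 ≤ 2 * (N3 * B3) := by positivity
  have h := blockBd_familyOp (R := R) (H := H) 𝔬.blk 𝔬.blk (P := P × P)
    (T := fun p : P × P => 𝔬.Gp U ∘ₗ (𝔡.Dsd U p.1 ∘ₗ 𝔡.Dsd U p.2))
    (fun a b => mul_nonneg hK (Real.exp_nonneg _))
    (fun p => l2line5_left_of_local342 𝔬 𝔡 𝔩 R H d d₁ δ α L₀ δ₁ α₁ ρ N N' Cℓ N3 B3 B₀ δ₀ κ S3 U hN' hN3 hB3 hB₀ hδ₀ hCℓ hκ hαδ hα₁δ₁ hα₁δ₁' hδ₁ hs hcnt3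
      h261 hF hi hl hT hL hDT hGsqT hPt hCt hsmall p.1 p.2)
  refine h.mono fun a b => le_of_eq ?_
  rw [Fintype.card_prod, Nat.cast_mul, Real.sqrt_mul_self (Nat.cast_nonneg _)]
  ring

/-- ★★★ **THE PACKAGED FAMILY `∇_{U,ν}∇_{U,μ}G′` OVER `P × P` FROM COROLLARY 3.6's LETTERS ALONE** (the drop-in for `blockBd_second_family3_37_dir`; `G′` symmetric).
[cite: Balaban1985BackgroundPropagators, (3.46) p.398 + (3.39) p.397 + (3.87)–(3.90) pp.408–410 + p.391] -/
theorem blockBd_second_family3_left_of_local342 [Fintype X] [DecidableEq X] [Fintype Y] [Fintype ι]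
    (𝔬 : Ops g B X Y ι) (𝔡 : DirOps37 𝔬 P) (𝔩 : DirLetters37 𝔬 P) (R : ℝ) (H : Prop) (d d₁ : ℕ) (δ α L₀ δ₁ α₁ ρ N N' Cℓ N3 B3 B₀ δ₀ : ℝ) (κ : Sizes)
    (S3 : ι → Finset g.Site) (U : B.Cfg)
    (hN' : 0 ≤ N') (hN3 : 0 ≤ N3) (hB3 : 0 ≤ B3) (hB₀ : 0 ≤ B₀) (hδ₀ : 0 ≤ δ₀) (hCℓ : 0 ≤ Cℓ) (hκ : κ.Nonneg) (hαδ : 0 ≤ α * δ)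
    (hα₁δ₁ : 0 ≤ α₁ * δ₁) (hα₁δ₁' : α₁ * δ₁ ≤ δ₁) (hδ₁ : δ₁ ≤ δ₀ - α * δ)
    (hs : StaticOK 𝔬 ρ N N' Cℓ κ) (hcnt3 : ∀ a : g.Site, (∑ i, if a ∈ S3 i then (1 : ℝ) else 0) ≤ N3)
    (h261 : Ineq261 d₁ (toB6 g R H) δ₁ α₁) (hF : Facts347 g R H d δ α L₀) (hi : Identities₂ 𝔬 𝔡 𝔩 R H U)
    (hl : Local342 𝔬 R H B₀ δ₀ U) (hT : DirSupSq37 𝔬 𝔡 R H U) (hL : L2SecondLegs37 𝔬 𝔡 R H S3 B3 δ₁ U)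
    (hDT : DirTranspose37 𝔬 𝔡 U) (hGsqT : ∀ i, IsTransposePair (𝔬.Gsq U i) (𝔬.Gsq U i)) (hPt : ∀ i μ, IsTransposePair (𝔩.Pt U i μ) (𝔩.P U i μ))
    (hCt : ∀ i, IsTransposePair (𝔬.Ct U i) (𝔬.Cop U i)) (hsym : IsTransposePair (𝔬.Gp U) (𝔬.Gp U))
    (hsmall : N' * Real.sqrt ((B₀ * Real.exp (δ₀ * ρ) * (κ.kPt + Cℓ * κ.kCt)) * (B₀ * Real.exp (δ₀ * ρ) * (κ.kP + κ.kC)) * L₀) * B6.c1 d₁ δ₁ α₁ ≤ 1 / 2) :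
    BlockBd (g := toB6 g R H) 𝔬.blk (𝔬.blk ∘ Prod.fst)
      (familyOp fun p : P × P => (𝔡.Dd U p.1 ∘ₗ 𝔡.Dd U p.2) ∘ₗ 𝔬.Gp U)
      (fun (a b : g.Site) => (Fintype.card P : ℝ) * (2 * (N3 * B3)) * Real.exp (-((1 - α₁) * δ₁ * g.dist a b))) := by
  have hK : 0 ≤ 2 * (N3 * B3) := by positivity
  have hV0 := blockBd_VDir_of_local342 (R := R) (H := H) 𝔬 𝔡 𝔩 U hF hαδ hB₀ hδ₀ hCℓ hN' hκ hs hl hT hi hDT hGsqT hPt hCt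
  have hθ : 0 ≤ N' * Real.sqrt ((B₀ * Real.exp (δ₀ * ρ) * (κ.kPt + Cℓ * κ.kCt)) * (B₀ * Real.exp (δ₀ * ρ) * (κ.kP + κ.kC)) * L₀) :=
    mul_nonneg hN' (Real.sqrt_nonneg _)
  have hV : BlockBd (g := toB6 g R H) 𝔬.blk 𝔬.blk (VDir 𝔬 𝔡 𝔩 U)
      (fun (a b : g.Site) => N' * Real.sqrt ((B₀ * Real.exp (δ₀ * ρ) * (κ.kPt + Cℓ * κ.kCt)) * (B₀ * Real.exp (δ₀ * ρ) * (κ.kP + κ.kC)) * L₀)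
        * Real.exp (-(δ₁ * g.dist a b))) := by
    refine hV0.mono fun a b => mul_le_mul_of_nonneg_left ?_ hθ
    exact Real.exp_le_exp.mpr (neg_le_neg (mul_le_mul_of_nonneg_right hδ₁ (hs.dnn a b)))
  have h := blockBd_familyOp (R := R) (H := H) 𝔬.blk 𝔬.blk (P := P × P)
    (T := fun p : P × P => (𝔡.Dd U p.1 ∘ₗ 𝔡.Dd U p.2) ∘ₗ 𝔬.Gp U)
    (fun a b => mul_nonneg hK (Real.exp_nonneg _))
    (fun p => l2line3_left_of_blockBd 𝔬 𝔡 𝔩 R H d₁ δ₁ α₁ ρ N N' Cℓ N3 B3 _ κ S3 U hN3 hB3 hθ hα₁δ₁ hα₁δ₁' hs hcnt3 h261 hi hL hV hsmall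
      hDT hsym p.1 p.2)
  refine h.mono fun a b => le_of_eq ?_
  rw [Fintype.card_prod, Nat.cast_mul, Real.sqrt_mul_self (Nat.cast_nonneg _)]
  ring

end GpSide

end

end Literature.MathematicalPhysics.QuantumFieldTheory.Balaban1983to89.B9RWSums346SecondDiffGpLeft
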